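import Literature.MathematicalPhysics.QuantumLattice.DWaveSourceNNNHoppingFlatTwistLocalDensity
import HarnessLib

/-!
# The thermodynamic-limit ground-state energy density `e_src^tw(t', U, μ, h; κ)` of the flat-twisted
# pair-sourced `t–t'` Hubbard torus (definition)

Topic `Literature/MathematicalPhysics/QuantumLattice` (namespace = path; family `hubbard`). Companion of
`DWaveSourceNNNHoppingFlatTwistLocalDensity.lean` (the gauge-rotated local objective
`dWaveSourceEnergyObsTT'Twist t' U μ h κ ∈ 𝔄_W`, whose torus translates sum to the T8 object
`dWaveSourceTorusTT'Twist L t' U μ h n` whenever `χ_L(n_i) = κ_i`, and to the uniformly twisted torus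
`dWaveSourceTorusTT'TwistU1 L t' U μ h κ` on every side; `exists_tendsto_groundEnergy_dWaveSourceTorusTT'TwistU1_div_sq`:
its ground-state energy density converges to the least mean energy of a translation-invariant state). This file
only NAMES that limit, so that the Hubbard cuprate cell's row T8 («sourced helicity chord», `hubbard-cq`) has a
constant to cite: the theorems (convergence of `E₀(dWaveSourceTorusTT'Twist L_j t' U μ h n_j)/L_j²` to it along
EVERY sequence of sides and twists with `χ_{L_j}(n_{j,i}) = κ_i`, variational characterisation, `κ = 1`, ladders,
existence of the helicity chord density) are in `DWaveSourceNNNHoppingFlatTwistThermodynamicLimit.lean`.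

* `dWaveSourceEnergyDensityTT'Twist t' U μ h κ = inf {Re ω(E^src_κ(t',U,μ,h)) : ω translation invariant}` —
  the Bratteli–Kishimoto–Robinson mean-energy minimum of the rotated objective (`κ ∈ U(1)²` the phase per unit
  bond, `κ_i = e^{iq_i/2}`); at `κ = 1` it is `dWaveSourceEnergyDensityTT' t' U μ h` (companion file).

HONEST SCOPE: a definition; grand-canonical (`Matrix.groundEnergy`) objects; hopping `t = 1`; no number,
nothing about superconductivity.

## References
* O. Bratteli, A. Kishimoto, D. W. Robinson, CMP 64 (1978) 41, Thm. 2 (translation-invariant ground states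
  minimise the mean energy). [cite: BratteliKishimotoRobinson1978, Thm. 2]
* T. Koma, H. Tasaki, J. Stat. Phys. 76 (1994) 745, §1 (sourced Hamiltonians on periodic boxes; volume limit
  first). [cite: KomaTasaki1994, §1]
* H. Watanabe, J. Stat. Phys. 177 (2019) 717, §2.2.1 (flat twists). [cite: Watanabe2019, §2.2.1]
-/

noncomputable section

namespace Literature.MathematicalPhysics.QuantumLattice

open _root_.Matrix Finset HubbardWave0 Literature.Probability.LatticeModels

/-- **The thermodynamic-limit ground-state energy density of the flat-twisted pair-sourced `t–t'` Hubbard torus**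
`e_src^tw(t', U, μ, h; κ) = inf {Re ω(E^src_κ(t',U,μ,h)) : ω a translation-invariant state of the lattice fermions
on ℤ²}` — the Bratteli–Kishimoto–Robinson mean-energy minimum of the gauge-rotated local objective
`dWaveSourceEnergyObsTT'Twist t' U μ h κ`; the companion file proves it is
`lim_j E₀(dWaveSourceTorusTT'Twist L_j t' U μ h n_j) / L_j²` along every sequence of sides `L_j → ∞` and twists
with `χ_{L_j}(n_{j,i}) = κ_i`, and that the infimum is attained. [cite: BratteliKishimotoRobinson1978, Thm. 2] -/
def dWaveSourceEnergyDensityTT'Twist (t' U μ h : ℝ) (κ : Fin 2 → Circle) : ℝ :=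
  sInf {x : ℝ | ∃ ω : InfVolFermionState 2, ω.IsTranslationInvariant ∧
    (ω.expect dWaveSourceWindow (dWaveSourceEnergyObsTT'Twist t' U μ h κ)).re = x}

end Literature.MathematicalPhysics.QuantumLattice

end
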